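import Summits.HodgeConjecture.HodgeConjecture.Theorems.K2E1SpectralTermsDiscreteHalf   -- ★ `DiscreteClass`, `DiscreteClass.mk ∕ out ∕ mk_out ∕ mk_eq_mk_iff` (+ the `L²` frame)
import Summits.HodgeConjecture.HodgeConjecture.Theorems.K2E1OccursCountable             -- ★ `countable_of_pairwise_inner_eq_zero` (orthogonal non-zero vectors of a separable space have countable index)
import Literature.NumberTheory.Automorphic.HilbertRepOrthogonalDecomposition            -- ★ `ClosedSubrep.isOrtho_of_not_areUnitarilyEquivalent`
import Literature.NumberTheory.Automorphic.AdelicSecondCountable                         -- ★ `secondCountableTopology_generalLinearGroup_adeleRing`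
import Mathlib.MeasureTheory.Measure.SeparableMeasure                                    -- `MeasureTheory.Lp.SecondCountableTopology`
import HarnessLib

/-!
# R90-TF · S10 (Ch. 13.5–13.8 comparison) — first payer «CUT COUNTABLE»: the discrete automorphic classes form a COUNTABLE type,
# hence every injective family of discrete classes has a countable index (`S10GCutCore.hcount`)

Cell `hodgecm-mathlib`, crux H413 (`stmt-HodgeConjecture-24833`, lane `--supports`), route of record `HCCMUnconditional` (no route verbs;
count-neutral).  Programme R90-TF (brief `director/R90-BRIEF.v2.md`), section S10 = Ch. 13.5–13.8 (base `R90-C138`), dealer R90-C138-plan (g0),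
DEAL-S10-WAVE0 15da258fdabf979c hand (3) «first payer `Theorems/R90S10CutCountable.lean`»; seat R90-C131-p03 (g0) as S10 PEN (LEAD #25 (2)).
THEOREMS ONLY (no `def`, no instance, no notation, no named fact, no `sorry`); imports ★ only (no `Lines` import, law L9).  HONEST LABEL: HC_CM is
proved only modulo the 7 printed citations (2 remaining named inputs: hLiu418 = stmt-HodgeConjecture-24832, h413 = stmt-HodgeConjecture-24833)
until rung 0 closes; this file is unconditional Hilbert-space bookkeeping.

PRINT.  (13.8.3) p. 218 «the sum is over cuspidal `π` on `G` such that `ψ_G(t(π)) = t`»; Prop. 13.8.1 p. 213 «`X` a countable set of irreducible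
unitary representations» — the discrete spectrum of `L²(G(F)\G(𝔸))` decomposes into countably many irreducibles [BorelJacquet1979, §4.6].
MATHEMATICS.  ★ `DiscreteClass 𝒢 μ` is the type of discrete automorphic representations (closed irreducible invariant subspaces of the unitary
`L²(G(𝔸_K) ⧸ A_G G(K), μ)`) modulo unitary equivalence.  Distinct classes have INEQUIVALENT irreducible representatives, which are ORTHOGONAL inside the
unitary `L²` (★ `ClosedSubrep.isOrtho_of_not_areUnitarilyEquivalent` — Schur: the orthogonal projection between them intertwines; Dixmier 5.4,
Deitmar–Echterhoff Cor. 6.1.9); picking a non-zero vector in each (irreducible ⇒ non-trivial, ★ `isTopIrreducible_iff`) gives a pairwise-orthogonal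
family of non-zero vectors of `L²`, which is SEPARABLE when `G(𝔸_K)` is second countable and `μ` is finite (Mathlib `Lp.SecondCountableTopology`), so
the index — the type of classes — is countable (★ `countable_of_pairwise_inner_eq_zero`).  Consequently ANY injective family `cl : ι → DiscreteClass 𝒢 μ`
has `Countable ι` — with no «link» to local classes needed (the route through ★ `OccursCountable` would require the local families to be injective in
`i`, which injectivity of `cl` does not give: inequivalent discrete representations may share all finite local components).

CONTENTS.
* §1 `countable_discreteClass` — generic `𝒢 : AdelicGroupData K` with `SecondCountableTopology 𝒢.Adelic`, any automorphic `μ`.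
* §2 `countable_of_injective_discreteClass` — `Countable ι` for injective `cl : ι → DiscreteClass 𝒢 μ` (Mathlib `Function.Injective.countable`).
* §3 `countable_discreteClass_unitary`, `countable_of_injective_discreteClass_unitary` — the unitary-group datum
  `adelicGroupData L⁺ L c N H` of the programme (`U(H)(𝔸_{L⁺}) ≤ GL_N(𝔸_L)` is second countable, ★ `secondCountableTopology_generalLinearGroup_adeleRing`):
  the shape of `S10GCutCore.hcount` for `cl : ι → DiscreteClass (G3 L) μG` (and of the `H`-side twin), `N`, `H` arbitrary.
DEPENDENCY CUT (CENSUS-FIRST): nothing beneath — ★ today (census `R90/R90-C131-p03/g0/S10/CENSUS-CutCountable.md`).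

## References
* [BorelJacquet1979] A. Borel, H. Jacquet, *Automorphic forms and automorphic representations*, Corvallis (1979), §4.6 (discrete spectrum).
* [Rogawski1990] J. D. Rogawski, *Automorphic Representations of Unitary Groups in Three Variables*, Ann. of Math. Stud. 123 (1990), §13.8 Prop. 13.8.1
  p. 213, (13.8.3) p. 218.
* [Dixmier1977] J. Dixmier, *C*-algebras* (1977), §5.4 (5.4.1–5.4.6).
* [DeitmarEchterhoff2014] A. Deitmar, S. Echterhoff, *Principles of Harmonic Analysis*, 2nd ed. (2014), Cor. 6.1.9.
* [ReedSimon1972] M. Reed, B. Simon, *Functional Analysis* I (1972), Thm. II.7 (separability of `L²`).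
-/

set_option autoImplicit false
-- the mandated namespace repeats `HodgeConjecture.HodgeConjecture`, as in every `Theorems/*.lean` of this sub-problem
set_option linter.dupNamespace false

noncomputable section

open NumberField IsDedekindDomain MeasureTheory
open scoped InnerProductSpace

open Literature.NumberTheory.Automorphic Literature.NumberTheory.Automorphic.UnitaryGroup
open ContRepresentation
open Summit.HodgeConjecture.HodgeConjecture.Cruxes.H413.K2E1SpectralTermsDiscreteHalf
open Summit.HodgeConjecture.HodgeConjecture.Cruxes.H413.K2E1OccursCountable (countable_of_pairwise_inner_eq_zero)

namespace Summit.HodgeConjecture.HodgeConjecture.R90.S10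

universe u

/-! ## §1 The discrete automorphic classes of a second-countable datum form a countable type -/

section Generic

variable {K : Type} [Field K] [NumberField K]

/-- **THE DISCRETE AUTOMORPHIC CLASSES ARE COUNTABLE.**  For an adelic group datum `𝒢` with second-countable `G(𝔸_K)` and an automorphic (finite,
invariant) measure `μ` on `G(𝔸_K) ⧸ A_G G(K)`, the type ★ `DiscreteClass 𝒢 μ` of discrete automorphic representations modulo unitary equivalence is
countable: distinct classes have inequivalent irreducible closed representatives in the unitary `L²`, hence ORTHOGONAL ones (★
`ClosedSubrep.isOrtho_of_not_areUnitarilyEquivalent`), a non-zero vector in each gives a pairwise-orthogonal family in the separable `L²`, and such a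
family has countable index (★ `countable_of_pairwise_inner_eq_zero`). [cite: BorelJacquet1979, §4.6] [cite: Dixmier1977, §5.4]
[cite: DeitmarEchterhoff2014, Cor. 6.1.9] -/
theorem countable_discreteClass (𝒢 : AdelicGroupData.{u} K) [SecondCountableTopology 𝒢.Adelic] (μ : Measure 𝒢.automorphicQuotient)
    [𝒢.IsAutomorphicMeasure μ] : Countable (DiscreteClass 𝒢 μ) := by
  classical
  -- `L²` is separable
  haveI : SecondCountableTopology 𝒢.automorphicQuotient :=
    inferInstanceAs (SecondCountableTopology (𝒢.Adelic ⧸ 𝒢.quotientSubgroup))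
  haveI : Fact ((2 : ENNReal) ≠ ⊤) := ⟨ENNReal.ofNat_ne_top⟩
  haveI : TopologicalSpace.SeparableSpace (𝒢.L2 μ) := inferInstance
  -- a non-zero vector in (the chosen representative of) each class
  have hex : ∀ c : DiscreteClass 𝒢 μ, ∃ u : 𝒢.L2 μ, u ≠ 0 ∧ u ∈ c.out.space.toSubmodule := by
    intro c
    haveI : Nontrivial ↥c.out.space.toSubmodule := ((isTopIrreducible_iff _).1 c.out.irreducible).1
    obtain ⟨⟨u, hu⟩, hne⟩ := exists_ne (0 : ↥c.out.space.toSubmodule)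
    exact ⟨u, fun h => hne (Subtype.ext h), hu⟩
  choose u hu0 hmem using hex
  -- distinct classes give orthogonal vectors
  have horth : Pairwise fun c c' => ⟪u c, u c'⟫_ℂ = 0 := by
    intro c c' hne
    have hne' : ¬ AreUnitarilyEquivalent c.out.space.toContRep c'.out.space.toContRep := fun h =>
      hne (by rw [← DiscreteClass.mk_out c, ← DiscreteClass.mk_out c']; exact (DiscreteClass.mk_eq_mk_iff _ _).2 h)
    exact (ClosedSubrep.isOrtho_of_not_areUnitarilyEquivalent (𝒢.isUnitary_rightRegular μ) c.out.irreducible c'.out.irreducible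
      hne').inner_eq (hmem c) (hmem c')
  exact countable_of_pairwise_inner_eq_zero u hu0 horth

/-! ## §2 … hence every injective family of discrete classes has a countable index -/

/-- **An injective family of discrete automorphic classes has countable index** — the shape of `S10GCutCore.hcount`: for `cl : ι → DiscreteClass 𝒢 μ`
injective, `Countable ι` (§1 + Mathlib `Function.Injective.countable`); no link to local components is needed. [cite: BorelJacquet1979, §4.6]
[cite: Rogawski1990, §13.8 Prop. 13.8.1 p. 213] -/
theorem countable_of_injective_discreteClass (𝒢 : AdelicGroupData.{u} K) [SecondCountableTopology 𝒢.Adelic] (μ : Measure 𝒢.automorphicQuotient)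
    [𝒢.IsAutomorphicMeasure μ] {ι : Type*} (cl : ι → DiscreteClass 𝒢 μ) (hcl : Function.Injective cl) : Countable ι := by
  haveI := countable_discreteClass 𝒢 μ
  exact hcl.countable

end Generic

/-! ## §3 The unitary-group datum of the programme: `U(H)(𝔸_{L⁺})` is second countable -/

section Unitary

variable (L : Type) [Field L] [NumberField L] [IsCMField L] (N : ℕ) (H : Matrix (Fin N) (Fin N) L)
  (μ : Measure (adelicGroupData (↥(maximalRealSubfield L)) L (IsCMField.complexConj L) N H).automorphicQuotient)
  [(adelicGroupData (↥(maximalRealSubfield L)) L (IsCMField.complexConj L) N H).IsAutomorphicMeasure μ]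

/-- **The discrete automorphic classes of `U(H)` are countable** (any `N`, any `H ∈ M_N(L)`, any automorphic `μ`): `U(H)(𝔸_{L⁺}) ≤ GL_N(𝔸_L)` is second
countable (★ `secondCountableTopology_generalLinearGroup_adeleRing`), so §1 applies. [cite: BorelJacquet1979, §4.6] [cite: Rogawski1990, §13.8 Prop. 13.8.1 p. 213] -/
theorem countable_discreteClass_unitary :
    Countable (DiscreteClass (adelicGroupData (↥(maximalRealSubfield L)) L (IsCMField.complexConj L) N H) μ) := by
  haveI : SecondCountableTopology (GL (Fin N) (AdeleRing (𝓞 L) L)) := secondCountableTopology_generalLinearGroup_adeleRing L (Fin N)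
  haveI : SecondCountableTopology (adelicGroupData (↥(maximalRealSubfield L)) L (IsCMField.complexConj L) N H).Adelic :=
    inferInstanceAs (SecondCountableTopology (adelic (↥(maximalRealSubfield L)) L (IsCMField.complexConj L) N H))
  exact countable_discreteClass _ μ

/-- **`S10GCutCore.hcount` ∕ its `H`-side twin**: every INJECTIVE family `cl : ι → DiscreteClass (U(H)-datum) μ` of discrete automorphic classes of a
unitary group has `Countable ι` — in particular the `t₀`-fibre family of (13.8.3) [p. 218 L5–L7]. [cite: Rogawski1990, §13.8 (13.8.3) p. 218; Prop. 13.8.1 p. 213]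
[cite: BorelJacquet1979, §4.6] -/
theorem countable_of_injective_discreteClass_unitary {ι : Type*}
    (cl : ι → DiscreteClass (adelicGroupData (↥(maximalRealSubfield L)) L (IsCMField.complexConj L) N H) μ) (hcl : Function.Injective cl) :
    Countable ι := by
  haveI := countable_discreteClass_unitary L N H μ
  exact hcl.countable

end Unitary

end Summit.HodgeConjecture.HodgeConjecture.R90.S10

end
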